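import Summits.Ventures.PercRepro.RankLevelSetBiIndepParallel
import Summits.Ventures.PercRepro.RankLevelSetBiIndepContainSkew

/-! # RankLevelSetBiIndepContainSkewParallel — THE PARALLEL-PAIR REDUCTION OF (CX*) AND (CX): THE CONTAIN-SET
SKEWNESS IS DECIDED ON SIMPLE MATROIDS; LOOPS ARE TRIVIAL (night-1 g30; dossier §42)

For a parallel pair `{y, z}` of `M` (`ParallelPair M y z`, `RankLevelSetBiIndepParallel`) and `N := M ／ {y} ＼ {z}`
(a matroid on `#E − 2` elements), every bi-independent set of `M` contains exactly one of `y`, `z`, and `S ↦ S ∖ {y}`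
(resp. `S ∖ {z}`) is a bijection from the bi-independent sets through `y` (resp. `z`) onto the bi-independent sets of
`N` one level down. For the contain-`X` profile `α^X_k = biContainCount M X k = #{Z ∈ D_k(M) : X ⊆ Z}`
(`RankLevelSetBiIndepContainMono`) this gives, level by level:
* `y ∈ X`, `z ∉ X`: `α^X_{r+1}(M) = α^{X ∖ {y}}_r(N)` (`biContainCount_parallel_mem_left`); symmetrically for `z`;
* `y, z ∈ X`: `α^X_k(M) = 0` (`biContainCount_parallel_both`);
* `y, z ∉ X`: `α^X_{r+1}(M) = 2·α^X_r(N)` (`biContainCount_parallel_notMem`);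
* level `0` is empty (`biContainCount_parallel_zero`).
Hence the two contain-set statements of the cell transfer exactly (the index ranges match: `2(r+1)+1 < #E ⟺ 2r+1 < #E−2`):
**`biContainSkew_parallel_iff : BiContainSkew M ↔ BiContainSkew (M ／ {y} ＼ {z})`** — (CX*), the contain-`X` skewness
`α^X_k ≤ α^X_{#E−1−k}` (`2k+1 < #E`), holds for `M` iff it holds for `N`; and
**`biContainMono_parallel_iff : BiContainMono M ↔ BiContainMono (M ／ {y} ＼ {z})`** — the same for (CX), the
monotonicity `α^X_k ≤ α^X_{k+1}` (`2(k+1) ≤ #E`). A loop empties every bi-independent family, so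
**`biContainSkew_of_loop`** / **`biContainMono_of_loop`** hold trivially. COROLLARY (paper): since a parallel class of
size ≥ 3 kills the bi-independent family (a set or its complement would contain two of its elements), (CX*) for every
finite matroid is decided by the SIMPLE matroids — the same reduction the cell has for (★★) (`biIndepPerElem_parallel_iff`,
g25) and C-025 («general case reduced to simple matroids»), now one floor up the kernel ladder
(CX*) on the minors ⟹ (PC) ⟹ (★★) ⟹ Mono. Nothing here asserts (CX*) or (CX); every declaration has a docstring;
imports: the cell's own modules and Mathlib only. Axioms: standard. -/

namespace PercRepro

open Set Matroid

variable {α : Type} (M : Matroid α) [M.Finite]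

/-! ## The contain-`X` counts of `M` through the parallel pair -/

omit [M.Finite] in
/-- For `y ∉ X`, the filters `X ⊆ insert y T` and `X ⊆ T` agree. -/
lemma filter_subset_insert_eq (𝒮 : Set (Set α)) {X : Set α} {y : α} (hyX : y ∉ X) :
    {T ∈ 𝒮 | X ⊆ insert y T} = {T ∈ 𝒮 | X ⊆ T} := by
  ext T
  simp only [Set.mem_setOf_eq]
  refine and_congr_right fun _ => ⟨fun h x hx => ?_, fun h => h.trans (Set.subset_insert y T)⟩
  rcases h hx with rfl | hxT
  · exact absurd hx hyX
  · exact hxT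

omit [M.Finite] in
/-- The filters `X ⊆ insert y T` and `X ∖ {y} ⊆ T` agree. -/
lemma filter_subset_insert_eq_sdiff (𝒮 : Set (Set α)) (X : Set α) (y : α) :
    {T ∈ 𝒮 | X ⊆ insert y T} = {T ∈ 𝒮 | X \ {y} ⊆ T} := by
  ext T
  simp only [Set.mem_setOf_eq, Set.sdiff_subset_iff, Set.singleton_union]

/-- **Through `y`**: for `y ∈ X`, `α^X_{r+1}(M) = α^{X ∖ {y}}_r(M ／ {y} ＼ {z})` (no bi-independent set through
`z` contains `X`). -/
lemma biContainCount_parallel_mem_left {y z : α} (h : ParallelPair M y z) {X : Set α} (hyX : y ∈ X) (r : ℕ) :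
    biContainCount M X (r + 1) = biContainCount (M ／ {y} ＼ {z}) (X \ {y}) r := by
  unfold biContainCount
  rw [ncard_biIndep_split M h (r + 1) (fun Z => X ⊆ Z)]
  have hz : {S ∈ biIndep M (r + 1) | z ∈ S ∧ X ⊆ S} = ∅ := by
    ext S
    simp only [Set.mem_setOf_eq, Set.mem_empty_iff_false, iff_false, not_and]
    intro hS hzS hXS
    exact biIndep_not_both M h hS ⟨hXS hyX, hzS⟩
  rw [hz, Set.ncard_empty, add_zero, ncard_biIndep_mem_left_eq M h r (fun Z => X ⊆ Z),
    filter_subset_insert_eq_sdiff]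

/-- **Through `z`**: for `z ∈ X`, `α^X_{r+1}(M) = α^{X ∖ {z}}_r(M ／ {y} ＼ {z})`. -/
lemma biContainCount_parallel_mem_right {y z : α} (h : ParallelPair M y z) {X : Set α} (hzX : z ∈ X) (r : ℕ) :
    biContainCount M X (r + 1) = biContainCount (M ／ {y} ＼ {z}) (X \ {z}) r := by
  unfold biContainCount
  rw [ncard_biIndep_split M h (r + 1) (fun Z => X ⊆ Z)]
  have hy : {S ∈ biIndep M (r + 1) | y ∈ S ∧ X ⊆ S} = ∅ := by
    ext S
    simp only [Set.mem_setOf_eq, Set.mem_empty_iff_false, iff_false, not_and]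
    intro hS hyS hXS
    exact biIndep_not_both M h hS ⟨hyS, hXS hzX⟩
  rw [hy, Set.ncard_empty, zero_add, ncard_biIndep_mem_right_eq M h r (fun Z => X ⊆ Z),
    filter_subset_insert_eq_sdiff]

/-- **Both**: a contain-set meeting both elements of a parallel pair has an empty profile. -/
lemma biContainCount_parallel_both {y z : α} (h : ParallelPair M y z) {X : Set α} (hyX : y ∈ X) (hzX : z ∈ X)
    (k : ℕ) : biContainCount M X k = 0 := by
  unfold biContainCount
  rw [Set.ncard_eq_zero ((biIndep_finite M k).subset (fun Z hZ => hZ.1))]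
  ext Z
  simp only [Set.mem_setOf_eq, Set.mem_empty_iff_false, iff_false, not_and]
  intro hZ hXZ
  exact biIndep_not_both M h hZ ⟨hXZ hyX, hXZ hzX⟩

/-- **Neither**: for `y, z ∉ X`, `α^X_{r+1}(M) = 2·α^X_r(M ／ {y} ＼ {z})`. -/
lemma biContainCount_parallel_notMem {y z : α} (h : ParallelPair M y z) {X : Set α} (hyX : y ∉ X) (hzX : z ∉ X)
    (r : ℕ) : biContainCount M X (r + 1) = 2 * biContainCount (M ／ {y} ＼ {z}) X r := by
  unfold biContainCount
  rw [ncard_biIndep_split M h (r + 1) (fun Z => X ⊆ Z), ncard_biIndep_mem_left_eq M h r (fun Z => X ⊆ Z),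
    ncard_biIndep_mem_right_eq M h r (fun Z => X ⊆ Z), filter_subset_insert_eq _ hyX,
    filter_subset_insert_eq _ hzX]
  ring

/-- With a parallel pair there is no bi-independent `0`-set, so every contain profile vanishes at level `0`. -/
lemma biContainCount_parallel_zero {y z : α} (h : ParallelPair M y z) (X : Set α) :
    biContainCount M X 0 = 0 := by
  unfold biContainCount
  rw [biIndep_zero_eq_empty M h]
  simp

/-- A parallel pair lies in the ground set, so `#E ≥ 2`. -/
lemma two_le_ncard_of_parallel {y z : α} (h : ParallelPair M y z) : 2 ≤ M.E.ncard := by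
  rw [← Set.ncard_pair h.1]
  exact Set.ncard_le_ncard (Set.pair_subset h.2.1.mem_ground h.2.2.1.mem_ground) M.ground_finite

omit [M.Finite] in
/-- For `X ⊆ E` avoiding `z`, `X ∖ {y}` is inside the ground set of `M ／ {y} ＼ {z}`. -/
lemma sdiff_subset_ground_contract_delete {y z : α} {X : Set α} (hX : X ⊆ M.E) (hzX : z ∉ X) :
    X \ {y} ⊆ (M ／ {y} ＼ {z}).E := by
  rw [ground_contract_delete]
  intro x hx
  refine ⟨hX hx.1, ?_⟩
  simp only [Set.mem_insert_iff, Set.mem_singleton_iff, not_or]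
  exact ⟨hx.2, fun hxz => hzX (hxz ▸ hx.1)⟩

omit [M.Finite] in
/-- A subset of the ground set of `M ／ {y} ＼ {z}` avoids `y` and `z` and lies in `E`. -/
lemma of_subset_ground_contract_delete {y z : α} {X : Set α} (hX : X ⊆ (M ／ {y} ＼ {z}).E) :
    X ⊆ M.E ∧ y ∉ X ∧ z ∉ X := by
  rw [ground_contract_delete] at hX
  refine ⟨fun x hx => (hX hx).1, fun hy => (hX hy).2 (Set.mem_insert y _),
    fun hz => (hX hz).2 (Set.mem_insert_of_mem y rfl)⟩

/-! ## (CX*) transfers through a parallel pair -/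

/-- **THE REDUCTION FOR (CX*)**: if `N = M ／ {y} ＼ {z}` satisfies the contain-set skewness for a parallel pair
`{y, z}`, so does `M`. -/
theorem biContainSkew_of_parallel {y z : α} (h : ParallelPair M y z)
    (hN : BiContainSkew (M ／ {y} ＼ {z})) : BiContainSkew M := by
  intro X hX k hk
  have hn := ncard_ground_contract_delete M h
  rcases k with _ | r
  · rw [biContainCount_parallel_zero M h X]
    exact Nat.zero_le _
  · have hidx : M.E.ncard - 1 - (r + 1) = (M.E.ncard - 2 - 1 - r) + 1 := by omega
    by_cases hyX : y ∈ X <;> by_cases hzX : z ∈ X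
    · rw [biContainCount_parallel_both M h hyX hzX]
      exact Nat.zero_le _
    · rw [hidx, biContainCount_parallel_mem_left M h hyX, biContainCount_parallel_mem_left M h hyX]
      have := hN (X \ {y}) (sdiff_subset_ground_contract_delete M hX hzX) r (by rw [hn]; omega)
      rwa [hn] at this
    · rw [hidx, biContainCount_parallel_mem_right M h hzX, biContainCount_parallel_mem_right M h hzX]
      have := hN (X \ {z}) (by
        have := sdiff_subset_ground_contract_delete (M := M) (y := z) (z := y) hX hyX
        rwa [ground_contract_delete, Set.pair_comm, ← ground_contract_delete] at this) r (by rw [hn]; omega)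
      rwa [hn] at this
    · rw [hidx, biContainCount_parallel_notMem M h hyX hzX, biContainCount_parallel_notMem M h hyX hzX]
      have hX' : X ⊆ (M ／ {y} ＼ {z}).E := by
        rw [ground_contract_delete]
        intro x hx
        refine ⟨hX hx, ?_⟩
        simp only [Set.mem_insert_iff, Set.mem_singleton_iff, not_or]
        exact ⟨fun hxy => hyX (hxy ▸ hx), fun hxz => hzX (hxz ▸ hx)⟩
      have := hN X hX' r (by rw [hn]; omega)
      rw [hn] at this
      omega

/-- **THE CONVERSE**: if `M` satisfies (CX*) and `{y, z}` is a parallel pair, so does `N = M ／ {y} ＼ {z}`. -/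
theorem biContainSkew_contract_delete_of_parallel {y z : α} (h : ParallelPair M y z) (hM : BiContainSkew M) :
    BiContainSkew (M ／ {y} ＼ {z}) := by
  intro X hX r hr
  have hn := ncard_ground_contract_delete M h
  obtain ⟨hXE, hyX, hzX⟩ := of_subset_ground_contract_delete M hX
  have h2 := two_le_ncard_of_parallel M h
  have key := hM X hXE (r + 1) (by omega)
  have hidx : M.E.ncard - 1 - (r + 1) = ((M ／ {y} ＼ {z}).E.ncard - 1 - r) + 1 := by omega
  rw [hidx, biContainCount_parallel_notMem M h hyX hzX, biContainCount_parallel_notMem M h hyX hzX] at key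
  omega

/-- **(CX*) IS DECIDED ON SIMPLE MATROIDS**: for a parallel pair `{y, z}`,
`BiContainSkew M ↔ BiContainSkew (M ／ {y} ＼ {z})`. -/
theorem biContainSkew_parallel_iff {y z : α} (h : ParallelPair M y z) :
    BiContainSkew M ↔ BiContainSkew (M ／ {y} ＼ {z}) :=
  ⟨biContainSkew_contract_delete_of_parallel M h, biContainSkew_of_parallel M h⟩

/-! ## (CX) transfers through a parallel pair -/

/-- **THE REDUCTION FOR (CX)**: if `N = M ／ {y} ＼ {z}` satisfies the contain-set monotonicity for a parallel pair
`{y, z}`, so does `M`. -/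
theorem biContainMono_of_parallel {y z : α} (h : ParallelPair M y z)
    (hN : BiContainMono (M ／ {y} ＼ {z})) : BiContainMono M := by
  intro X hX k hk
  have hn := ncard_ground_contract_delete M h
  rcases k with _ | r
  · rw [biContainCount_parallel_zero M h X]
    exact Nat.zero_le _
  · by_cases hyX : y ∈ X <;> by_cases hzX : z ∈ X
    · rw [biContainCount_parallel_both M h hyX hzX]
      exact Nat.zero_le _
    · rw [biContainCount_parallel_mem_left M h hyX, biContainCount_parallel_mem_left M h hyX]
      exact hN (X \ {y}) (sdiff_subset_ground_contract_delete M hX hzX) r (by rw [hn]; omega)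
    · rw [biContainCount_parallel_mem_right M h hzX, biContainCount_parallel_mem_right M h hzX]
      exact hN (X \ {z}) (by
        have := sdiff_subset_ground_contract_delete (M := M) (y := z) (z := y) hX hyX
        rwa [ground_contract_delete, Set.pair_comm, ← ground_contract_delete] at this) r (by rw [hn]; omega)
    · rw [biContainCount_parallel_notMem M h hyX hzX, biContainCount_parallel_notMem M h hyX hzX]
      have hX' : X ⊆ (M ／ {y} ＼ {z}).E := by
        rw [ground_contract_delete]
        intro x hx
        refine ⟨hX hx, ?_⟩
        simp only [Set.mem_insert_iff, Set.mem_singleton_iff, not_or]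
        exact ⟨fun hxy => hyX (hxy ▸ hx), fun hxz => hzX (hxz ▸ hx)⟩
      have := hN X hX' r (by rw [hn]; omega)
      omega

/-- **THE CONVERSE FOR (CX)**: if `M` satisfies (CX) and `{y, z}` is a parallel pair, so does `M ／ {y} ＼ {z}`. -/
theorem biContainMono_contract_delete_of_parallel {y z : α} (h : ParallelPair M y z) (hM : BiContainMono M) :
    BiContainMono (M ／ {y} ＼ {z}) := by
  intro X hX r hr
  have hn := ncard_ground_contract_delete M h
  obtain ⟨hXE, hyX, hzX⟩ := of_subset_ground_contract_delete M hX
  have h2 := two_le_ncard_of_parallel M h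
  have key := hM X hXE (r + 1) (by omega)
  rw [biContainCount_parallel_notMem M h hyX hzX, biContainCount_parallel_notMem M h hyX hzX] at key
  omega

/-- **(CX) IS DECIDED ON SIMPLE MATROIDS**: for a parallel pair `{y, z}`,
`BiContainMono M ↔ BiContainMono (M ／ {y} ＼ {z})`. -/
theorem biContainMono_parallel_iff {y z : α} (h : ParallelPair M y z) :
    BiContainMono M ↔ BiContainMono (M ／ {y} ＼ {z}) :=
  ⟨biContainMono_contract_delete_of_parallel M h, biContainMono_of_parallel M h⟩

/-! ## Loops -/

omit [M.Finite] in
/-- A loop empties every bi-independent level: a set containing it, or its complement, is dependent. -/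
lemma biIndep_eq_empty_of_loop {ℓ : α} (hℓE : ℓ ∈ M.E) (hℓ : ¬ M.Indep {ℓ}) (k : ℕ) : biIndep M k = ∅ := by
  ext Z
  simp only [Set.mem_empty_iff_false, iff_false]
  rintro ⟨hZE, -, hZ, hZc⟩
  by_cases hℓZ : ℓ ∈ Z
  · exact hℓ (hZ.subset (Set.singleton_subset_iff.mpr hℓZ))
  · exact hℓ (hZc.subset (Set.singleton_subset_iff.mpr ⟨hℓE, hℓZ⟩))

omit [M.Finite] in
/-- With a loop every contain profile vanishes. -/
lemma biContainCount_eq_zero_of_loop {ℓ : α} (hℓE : ℓ ∈ M.E) (hℓ : ¬ M.Indep {ℓ}) (X : Set α) (k : ℕ) :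
    biContainCount M X k = 0 := by
  unfold biContainCount
  rw [biIndep_eq_empty_of_loop M hℓE hℓ k]
  simp

omit [M.Finite] in
/-- **A matroid with a loop satisfies (CX*)** (trivially: every level is empty). -/
theorem biContainSkew_of_loop {ℓ : α} (hℓE : ℓ ∈ M.E) (hℓ : ¬ M.Indep {ℓ}) : BiContainSkew M := by
  intro X _ k _
  rw [biContainCount_eq_zero_of_loop M hℓE hℓ X k]
  exact Nat.zero_le _

omit [M.Finite] in
/-- **A matroid with a loop satisfies (CX)** (trivially: every level is empty). -/
theorem biContainMono_of_loop {ℓ : α} (hℓE : ℓ ∈ M.E) (hℓ : ¬ M.Indep {ℓ}) : BiContainMono M := by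
  intro X _ k _
  rw [biContainCount_eq_zero_of_loop M hℓE hℓ X k]
  exact Nat.zero_le _

end PercRepro
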